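import Summits.QuantumFields.YangMills.Theses.ConvexGribovBody
import Summits.QuantumFields.YangMills.Theorems.ConvexGribovBodyBrascampLiebVacuumStubPairIneq
import Summits.QuantumFields.YangMills.Theorems.ConvexGribovBodyBrascampLiebVacuumStubAbsSqrt
import Summits.QuantumFields.YangMills.Theorems.ConvexGribovBodyBrascampLiebVacuumStubRpHankel
import Summits.QuantumFields.YangMills.Theorems.ConvexGribovBodyBrascampLiebVacuumStubPolyaSzego
import Summits.QuantumFields.YangMills.Theorems.ConvexGribovBodyBrascampLiebVacuumStubMomentCone

/-!
# Crux `BrascampLiebVacuum` (stmt-QuantumFields-8779) via the line `SketchIdeator2` /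
card `rp-square-root-transfer` — skeleton v7 (continuation lead c1, 2026-08-16)

Route `ConvexGribovBody` of `YangMills`; crux (concluded BY NAME in `BrascampLiebVacuum_of`):
`Summit.QuantumFields.YangMills.Theses.ConvexGribovBody.BrascampLiebVacuum` — the volume-uniform
weak-coupling Poincaré inequality `Var_μ f ≤ C · Dmax · dir f` for gauge-invariant link-Lipschitz
functions `f` of the time-zero spatial links under Wilson's measure `μ` on the torus `(2S+1)⁴`.

## The line (reflection-positivity square root, THERMAL form, chart-free and operator-free)

Notation (plain integrals against `μ = wilsonMeasure r.ρ β`, `L = 2S+1`, `τ_u` = translation by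
`u` lattice units in Euclidean time, `m = E_μ f`, `G(u) = E_μ (f - m)(f ∘ τ_u - m)`):
`Var = G(0)`, `c(f) = E_μ (f - f ∘ τ₁)² = 2G(0) - 2G(1)` (one-step quadratic variation),
`b(f) = Σ_{u<L} G(u)` (zero-frequency susceptibility; `b/L` = variance of the time average).

Registered stubs of v7 (the first two are PROVED — proofs in the lead's folder, landing as
`--supports` files; the last two are the open physics):
* `stub_thermalSqrt` (MATHEMATICS, proved from the five landed stubs `stub_rpHankel` p99143,
  `stub_momentCone` p105593, `stub_polyaSzego` p105371, `stub_pairIneq` p97319, `stub_absSqrt` p97205):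
  `Var ≤ 3√(c·b) + 4b/L` for every link-Lipschitz `f` of the slice, every `β ≥ 0`, every `S` —
  odd-torus Osterwalder–Seiler positivity + time-translation invariance ⇒ `G` symmetric with both
  truncated Hankel forms PSD ⇒ (cone duality + Pólya–Szegő) `G` in the closed cone of pair
  sequences `(q^u+q^{L-u})/2`, `q ∈ [0,1]` ⇒ per-pair inequality + Cauchy–Schwarz + `ε → 0`.
* `stub_transport` (ALGEBRA, proved): for gauge-invariant `f` depending on the time-zero spatial
  links only, `f (τ₁ U) = f (P • U₀)` EXACTLY, `(P • U₀)(x,j) = plaquetteHolonomy U x 0 j · U(x,j)`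
  on the slice: one Euclidean time step multiplies every time-zero spatial link by the temporal
  plaquette through it (gauge transformation `h x := U (x, 0)`, then locality). Hence
  `c(f) = E_μ (f - f(P • U₀))²`: the one-step variation is the response of `f` to the field of
  temporal-plaquette kicks, of mean square `2·E(N - Re tr ρ U_p)` per link.
* `stub_product` (PHYSICS, OPEN, crux-sized — the card's lever (P), stated on the kick field):
  `E_μ (f - f(P • U₀))² · b(f) ≤ C_P · Dmax² · (dir f)²`.
* `stub_zeroMode` (PHYSICS, OPEN, NECESSARY — implied by the crux with `C_B = C`, kernel-checked as
  `stub_zeroMode_of_crux` in the lead's folder, because `G(t) ≤ G(0)` gives `b ≤ L · Var`):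
  `b(f) ≤ C_B · L · Dmax · dir f`.
* `BrascampLiebVacuum_of`: `Var ≤ 3√(cb) + 4b/L ≤ (3√C_P + 4C_B) · Dmax · dir f`.

## What v6 tried and why it is withdrawn (lead c1 + stub worker, 2026-08-16)

v6 split (P) into the card's one-scale factors with β-UNIFORM constants: the ultraviolet one-step
bound (C) `c(f) ≤ C_C · plaq · dir f` (`plaq` = mean temporal plaquette action `≍ dim G/β`) and the
infrared susceptibility bound (B) `plaq · b(f) ≤ C_B · Dmax² · dir f`. (C) is FALSE at the physics
level for every `(G, r)` with a strict local trap of the Wilson action, e.g. `SU(N ≥ 5)` fundamental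
(`cos 2π/N > 0`: the single-link centre defect `U_ℓ = e^{2πi/N}·1` is a non-degenerate local minimum,
`Re tr (z e^{iX}) = N cos φ - (cos φ/2) tr X² + O(X³)`): for the smooth basin indicator `f` of one
time-zero defect, `c(f) ≈ 2 Var f` (the transfer step removes the defect with probability
`1 - O(e^{-4uβ})`, `u = N(1 - cos 2π/N)` — Wilson's one-step kinetic cost is BOUNDED), while
`dir f ≲ e^{-δβ} Var f` (the slice law leaves the basin only through an exponentially rarer rim),
so `c/(plaq · dir f) ≳ e^{δβ} → ∞`. The crux itself survives such traps exactly when `Dmax(β)`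
outgrows `e^{δβ}` (soft spot F3 of `Cruxes/BrascampLiebVacuum/Disproof.lean`; physically dead for
`SU(N ≥ 16)`, alive for small `N`); (P) survives them up to an extra factor `√m_G` on trap + glueball
mixtures (`√(c·b)` mixes fast and slow spectral weight geometrically), i.e. it is crux-strength with a
slightly worse `N`-threshold; any split of (P) whose `c`-factor has a β-bounded right side is dead.
MORAL for planners: under the recommended repair (constants AFTER `β`) all of (P), (Z), (C), (B) are
consistent, but each remaining physics stub is of mass-gap strength at fixed `β`; this line cannot
make the crux easier — its durable output is the unconditional RP engine `stub_thermalSqrt`, the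
transport identity, and the necessity of the zero-mode stub.

Disproof used (Cruxes/BrascampLiebVacuum/Disproof.lean): F0 no kill; F2 hypotheses (ii) locality and
(iii) Lipschitz necessary — both used here ((ii): `f ∘ τ_t` lives on slice `t`, which is what makes
the RP Hankel forms and the transport identity available; (iii): continuity/measurability in
`stub_rpHankel` and the only non-junk meaning of `dir`); F3 (`C` before `β`) inherited verbatim by the
two physics stubs and, strictly worse, by any β-uniform UV/IR split (above).
-/

open scoped BigOperators Topology Matrix
open Filter MeasureTheory
open Literature.MathematicalPhysics.QuantumFieldTheory

noncomputable section

namespace Summit.QuantumFields.YangMills.Theorems.BrascampLiebVacuum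

/-! ### Mathematical stubs (proved in the lead's folder; landing as `--supports` files) -/

/-- **Stub (MATHEMATICS, proved — thermal reflection-positivity square root).**
`Var_μ f ≤ 3 √(c(f) b(f)) + 4 b(f) / (2S+1)` for link-Lipschitz functions of the time-zero spatial
links, `β ≥ 0`: `stub_rpHankel` feeds `stub_momentCone`; on the resulting finite pair decomposition
`Var`, `c`, `b` are the combinations of the pair weights of `stub_pairIneq`, and `stub_absSqrt` sums
up; then `ε → 0` over the closed cone. The `4b/L` term is the exact finite-temperature (period-`L`)
correction replacing the uncontrollable sup-norm remainder of the zero-temperature form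
`Var² ≤ ½ c b`. [folklore] -/
theorem stub_thermalSqrt
    (G : Type) [Group G] [TopologicalSpace G] [IsTopologicalGroup G] [CompactSpace G]
    [MeasurableSpace G] [BorelSpace G] (r : LatticeRep G) (β : ℝ) (hβ : 0 ≤ β) (S : ℕ) :
    let μ := wilsonMeasure (d := 4) (L := 2 * S + 1) r.ρ β
    let fro : Matrix (Fin r.N) (Fin r.N) ℂ → ℝ := fun M => ∑ a, ∑ b, ‖M a b‖ ^ 2
    let τ : ℕ → GaugeConfig 4 (2 * S + 1) G → GaugeConfig 4 (2 * S + 1) G :=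
      fun t U e => U (e.1 + Pi.single 0 ((t : ℕ) : ZMod (2 * S + 1)), e.2)
    ∀ f : GaugeConfig 4 (2 * S + 1) G → ℝ,
      (∀ U V : GaugeConfig 4 (2 * S + 1) G,
        (∀ e : Edge 4 (2 * S + 1), e.1 0 = 0 → e.2 ≠ 0 → U e = V e) → f U = f V) →
      (∃ K : ℝ, ∀ U V : GaugeConfig 4 (2 * S + 1) G,
        |f U - f V| ≤ K * ∑ e, Real.sqrt (fro (r.ρ (U e) - r.ρ (V e)))) →
      ∫ U, (f U - ∫ V, f V ∂μ) ^ 2 ∂μ ≤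
        3 * Real.sqrt ((∫ U, (f U - f (τ 1 U)) ^ 2 ∂μ) *
              (∑ t ∈ Finset.range (2 * S + 1),
                ∫ U, (f U - ∫ V, f V ∂μ) * (f (τ t U) - ∫ V, f V ∂μ) ∂μ)) +
          4 * (∑ t ∈ Finset.range (2 * S + 1),
                ∫ U, (f U - ∫ V, f V ∂μ) * (f (τ t U) - ∫ V, f V ∂μ) ∂μ) / (2 * S + 1 : ℝ) := by
  sorry

/-- **Stub (ALGEBRA, proved — transport identity `f ∘ τ₁ = f (P • U₀)`).** For a gauge-invariant `f`
depending only on the time-zero spatial links, translating by one unit of Euclidean time is the same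
as multiplying every time-zero spatial link `U(x,j)` (`x₀ = 0`, `j ≠ 0`) on the left by the temporal
plaquette `plaquetteHolonomy U x 0 j = U(x,0) U(x+e₀,j) U(x+e_j,0)⁻¹ U(x,j)⁻¹` through it: apply the
gauge transformation `h x := U (x, 0)` to `τ₁ U`, then locality. Every torus `(2S+1)⁴`, `S ≥ 0`. [folklore] -/
theorem stub_transport :
    ∀ (G : Type) [Group G] (S : ℕ) (f : GaugeConfig 4 (2 * S + 1) G → ℝ), IsGaugeInvariant f →
      (∀ U V : GaugeConfig 4 (2 * S + 1) G,
        (∀ e : Edge 4 (2 * S + 1), e.1 0 = 0 → e.2 ≠ 0 → U e = V e) → f U = f V) →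
      ∀ U : GaugeConfig 4 (2 * S + 1) G,
        f (fun e => U (e.1 + Pi.single 0 ((1 : ℕ) : ZMod (2 * S + 1)), e.2)) =
          f (fun e => if e.1 0 = 0 ∧ e.2 ≠ 0 then plaquetteHolonomy U e.1 0 e.2 * U e else U e) := by
  sorry

/-! ### Physics stubs (functionals of the explicit four-dimensional Wilson measure) -/

/-- **Stub (PHYSICS — the card's lever (P), crux-sized; stated on the kick field).** For every compact
simple `G` and `r` there are `C_P > 0` and `β₀` such that for `β ≥ β₀`, `S ≥ S₀(β)` and every
gauge-invariant link-Lipschitz `f` of the time-zero spatial links: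
`E_μ (f - f(P • U₀))² · b(f) ≤ C_P · Dmax² · (dir f)²`, where `(P • U₀) = kick U` multiplies each
time-zero spatial link by the temporal plaquette through it (`= f ∘ τ₁` by `stub_transport`, so the
first factor is `c(f)`), `b` is the zero-frequency susceptibility, `Dmax`, `dir` verbatim from the
crux. Spectrally `c·b ≈ 2–4 · Var²` on single modes (heavy or light), so (P) is the crux's inequality
in product form; free lattice gluons: `c_k b_k ≤ 4 D_k²`. It inherits the crux's soft spot F3 (`C_P`
before `β`: trap obstruction for `SU(N)` at large `N`, here with an extra `√m_G` loss on trap+glueball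
mixtures); do NOT split it into β-uniform UV × IR factors (module docstring). [folklore] -/
theorem stub_product :
    ∀ (G : Type) [Group G] [TopologicalSpace G] [IsTopologicalGroup G] [CompactSpace G]
      [MeasurableSpace G] [BorelSpace G], IsCompactSimpleLieGroup G → ∀ r : LatticeRep G,
      ∃ C_P : ℝ, 0 < C_P ∧ ∃ β₀ : ℝ, ∀ β : ℝ, β₀ ≤ β → ∃ S₀ : ℕ, ∀ S : ℕ, S₀ ≤ S →
      let μ := wilsonMeasure (d := 4) (L := 2 * S + 1) r.ρ β
      let fro : Matrix (Fin r.N) (Fin r.N) ℂ → ℝ := fun M => ∑ a, ∑ b, ‖M a b‖ ^ 2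
      let coul : GaugeConfig 4 (2 * S + 1) G → (Site 4 (2 * S + 1) → G) → ℝ := fun U h =>
        -∑ e : Edge 4 (2 * S + 1),
          (if e.1 0 = 0 ∧ e.2 ≠ 0 then (r.ρ (gaugeTransform h U e)).trace.re else 0)
      let cov : GaugeConfig 4 (2 * S + 1) G → (Site 4 (2 * S + 1) → G) →
          (Fin 3 → ZMod (2 * S + 1)) → ℝ := fun U h p =>
        (∑ j : Fin 3, fro (∑ y : Fin 3 → ZMod (2 * S + 1),
          Complex.exp (-(2 * Real.pi * Complex.I *
            (∑ i : Fin 3, ((p i).val : ℂ) * ((y i).val : ℂ)) / (2 * S + 1 : ℂ))) •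
          ((1 / 2 : ℂ) • (r.ρ (gaugeTransform h U (Fin.cons (0 : ZMod (2 * S + 1)) y, j.succ)) -
            (r.ρ (gaugeTransform h U (Fin.cons (0 : ZMod (2 * S + 1)) y, j.succ)))ᴴ)))) /
          ((2 * S + 1 : ℝ) ^ 3)
      let Dmax : ℝ := ⨆ p : Fin 3 → ZMod (2 * S + 1),
        ∫ U, (⨆ h : {h : Site 4 (2 * S + 1) → G // ∀ h', coul U h ≤ coul U h'}, cov U h.1 p) ∂μ
      let slope : (GaugeConfig 4 (2 * S + 1) G → ℝ) → GaugeConfig 4 (2 * S + 1) G →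
          Edge 4 (2 * S + 1) → ℝ := fun f U e =>
        Filter.limsup (fun g : G => |f (Function.update U e g) - f U| /
          Real.sqrt (fro (r.ρ g - r.ρ (U e)))) (𝓝[≠] (U e))
      let dir : (GaugeConfig 4 (2 * S + 1) G → ℝ) → ℝ := fun f =>
        ∑ e : Edge 4 (2 * S + 1), (if e.1 0 = 0 ∧ e.2 ≠ 0 then ∫ U, (slope f U e) ^ 2 ∂μ else 0)
      let τ : ℕ → GaugeConfig 4 (2 * S + 1) G → GaugeConfig 4 (2 * S + 1) G :=
        fun t U e => U (e.1 + Pi.single 0 ((t : ℕ) : ZMod (2 * S + 1)), e.2)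
      let kick : GaugeConfig 4 (2 * S + 1) G → GaugeConfig 4 (2 * S + 1) G :=
        fun U e => if e.1 0 = 0 ∧ e.2 ≠ 0 then plaquetteHolonomy U e.1 0 e.2 * U e else U e
      ∀ f : GaugeConfig 4 (2 * S + 1) G → ℝ, IsGaugeInvariant f →
        (∀ U V : GaugeConfig 4 (2 * S + 1) G,
          (∀ e : Edge 4 (2 * S + 1), e.1 0 = 0 → e.2 ≠ 0 → U e = V e) → f U = f V) →
        (∃ K : ℝ, ∀ U V : GaugeConfig 4 (2 * S + 1) G,
          |f U - f V| ≤ K * ∑ e, Real.sqrt (fro (r.ρ (U e) - r.ρ (V e)))) →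
        (∫ U, (f U - f (kick U)) ^ 2 ∂μ) *
            (∑ t ∈ Finset.range (2 * S + 1),
              ∫ U, (f U - ∫ V, f V ∂μ) * (f (τ t U) - ∫ V, f V ∂μ) ∂μ) ≤
          C_P * Dmax ^ 2 * (dir f) ^ 2 := by
  sorry

/-- **Stub (PHYSICS — zero-mode Poincaré inequality; a NECESSARY condition, implied by the crux
because the variance of the time average is at most `Var f`).** For every compact simple `G` and `r`
there are `C_B > 0` and `β₀` such that for `β ≥ β₀`, `S ≥ S₀(β)` and every admissible `f`:
`b(f) ≤ C_B · (2S+1) · Dmax · dir f`, i.e. `Var_μ(f̄) ≤ C_B · Dmax · dir f` for the time average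
`f̄ = (2S+1)⁻¹ Σ_t f ∘ τ_t` (a Poincaré inequality for ONE zero-Matsubara-frequency observable of the
explicit 4d Gibbs measure). It absorbs the thermal term `4 b / (2S+1)` of `thermal_sqrt`. [folklore] -/
theorem stub_zeroMode :
    ∀ (G : Type) [Group G] [TopologicalSpace G] [IsTopologicalGroup G] [CompactSpace G]
      [MeasurableSpace G] [BorelSpace G], IsCompactSimpleLieGroup G → ∀ r : LatticeRep G,
      ∃ C_B : ℝ, 0 < C_B ∧ ∃ β₀ : ℝ, ∀ β : ℝ, β₀ ≤ β → ∃ S₀ : ℕ, ∀ S : ℕ, S₀ ≤ S →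
      let μ := wilsonMeasure (d := 4) (L := 2 * S + 1) r.ρ β
      let fro : Matrix (Fin r.N) (Fin r.N) ℂ → ℝ := fun M => ∑ a, ∑ b, ‖M a b‖ ^ 2
      let coul : GaugeConfig 4 (2 * S + 1) G → (Site 4 (2 * S + 1) → G) → ℝ := fun U h =>
        -∑ e : Edge 4 (2 * S + 1),
          (if e.1 0 = 0 ∧ e.2 ≠ 0 then (r.ρ (gaugeTransform h U e)).trace.re else 0)
      let cov : GaugeConfig 4 (2 * S + 1) G → (Site 4 (2 * S + 1) → G) →
          (Fin 3 → ZMod (2 * S + 1)) → ℝ := fun U h p =>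
        (∑ j : Fin 3, fro (∑ y : Fin 3 → ZMod (2 * S + 1),
          Complex.exp (-(2 * Real.pi * Complex.I *
            (∑ i : Fin 3, ((p i).val : ℂ) * ((y i).val : ℂ)) / (2 * S + 1 : ℂ))) •
          ((1 / 2 : ℂ) • (r.ρ (gaugeTransform h U (Fin.cons (0 : ZMod (2 * S + 1)) y, j.succ)) -
            (r.ρ (gaugeTransform h U (Fin.cons (0 : ZMod (2 * S + 1)) y, j.succ)))ᴴ)))) /
          ((2 * S + 1 : ℝ) ^ 3)
      let Dmax : ℝ := ⨆ p : Fin 3 → ZMod (2 * S + 1),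
        ∫ U, (⨆ h : {h : Site 4 (2 * S + 1) → G // ∀ h', coul U h ≤ coul U h'}, cov U h.1 p) ∂μ
      let slope : (GaugeConfig 4 (2 * S + 1) G → ℝ) → GaugeConfig 4 (2 * S + 1) G →
          Edge 4 (2 * S + 1) → ℝ := fun f U e =>
        Filter.limsup (fun g : G => |f (Function.update U e g) - f U| /
          Real.sqrt (fro (r.ρ g - r.ρ (U e)))) (𝓝[≠] (U e))
      let dir : (GaugeConfig 4 (2 * S + 1) G → ℝ) → ℝ := fun f =>
        ∑ e : Edge 4 (2 * S + 1), (if e.1 0 = 0 ∧ e.2 ≠ 0 then ∫ U, (slope f U e) ^ 2 ∂μ else 0)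
      let τ : ℕ → GaugeConfig 4 (2 * S + 1) G → GaugeConfig 4 (2 * S + 1) G :=
        fun t U e => U (e.1 + Pi.single 0 ((t : ℕ) : ZMod (2 * S + 1)), e.2)
      ∀ f : GaugeConfig 4 (2 * S + 1) G → ℝ, IsGaugeInvariant f →
        (∀ U V : GaugeConfig 4 (2 * S + 1) G,
          (∀ e : Edge 4 (2 * S + 1), e.1 0 = 0 → e.2 ≠ 0 → U e = V e) → f U = f V) →
        (∃ K : ℝ, ∀ U V : GaugeConfig 4 (2 * S + 1) G,
          |f U - f V| ≤ K * ∑ e, Real.sqrt (fro (r.ρ (U e) - r.ρ (V e)))) →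
        (∑ t ∈ Finset.range (2 * S + 1),
            ∫ U, (f U - ∫ V, f V ∂μ) * (f (τ t U) - ∫ V, f V ∂μ) ∂μ) ≤
          C_B * (2 * S + 1 : ℝ) * Dmax * dir f := by
  sorry

/-! ### The kernel-checked composition -/

/-- **The crux from the stubs** (deciding theorem; its type is literally the route decl).
`C = 3 √C_P + 4 C_B`, `β₀ = max (max β₁ β₂) 0`, `S₀ = max S₁ S₂`; then
`Var ≤ 3√(c b) + 4 b/(2S+1)` (`stub_thermalSqrt`), `c = E_μ (f - f(P • U₀))²` (`stub_transport`),
`≤ 3 √(C_P Dmax² dir²) + 4 C_B Dmax dir = C · Dmax · dir f` (`stub_product`, `stub_zeroMode`), using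
`0 ≤ Dmax` (suprema/integrals of sums of squared norms) and `0 ≤ dir f`. [folklore] -/
theorem BrascampLiebVacuum_of :
    Summit.QuantumFields.YangMills.Theses.ConvexGribovBody.BrascampLiebVacuum := by
  intro G _ _ _ _ _ _ hG r
  obtain ⟨C_P, hCP, β₁, hP⟩ := stub_product G hG r
  obtain ⟨C_B, hCB, β₂, hBz⟩ := stub_zeroMode G hG r
  refine ⟨3 * Real.sqrt C_P + 4 * C_B, by positivity, max (max β₁ β₂) 0, fun β hβ => ?_⟩
  have hβ₁ : β₁ ≤ β := le_trans (le_trans (le_max_left _ _) (le_max_left _ _)) hβ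
  have hβ₂ : β₂ ≤ β := le_trans (le_trans (le_max_right _ _) (le_max_left _ _)) hβ
  have hβ0 : 0 ≤ β := le_trans (le_max_right _ _) hβ
  obtain ⟨S₁, hS₁⟩ := hP β hβ₁
  obtain ⟨S₂, hS₂⟩ := hBz β hβ₂
  refine ⟨max S₁ S₂, fun S hS => ?_⟩
  intro μ fro coul cov Dmax slope dir f hf₁ hf₂ hf₃
  have hA := hS₁ S (le_trans (le_max_left _ _) hS) f hf₁ hf₂ hf₃
  have hB := hS₂ S (le_trans (le_max_right _ _) hS) f hf₁ hf₂ hf₃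
  have hT := stub_thermalSqrt G r β hβ0 S f hf₂ hf₃
  -- one Euclidean time step = the field of temporal-plaquette kicks (`stub_transport`)
  have hct : (∫ U, (f U - f ((fun t U e => U (e.1 + Pi.single 0 ((t : ℕ) : ZMod (2 * S + 1)), e.2) :
      ℕ → GaugeConfig 4 (2 * S + 1) G → GaugeConfig 4 (2 * S + 1) G) 1 U)) ^ 2 ∂μ) =
      ∫ U, (f U - f ((fun U e => if e.1 0 = 0 ∧ e.2 ≠ 0 then plaquetteHolonomy U e.1 0 e.2 * U e
        else U e : GaugeConfig 4 (2 * S + 1) G → GaugeConfig 4 (2 * S + 1) G) U)) ^ 2 ∂μ := by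
    refine integral_congr_ae (ae_of_all _ fun U => ?_)
    beta_reduce
    rw [stub_transport G S f hf₁ hf₂ U]
  have hL : (0 : ℝ) < (2 * S + 1 : ℝ) := by positivity
  have hdir : 0 ≤ dir f := by
    refine Finset.sum_nonneg fun e _ => ?_
    split_ifs
    · exact integral_nonneg fun U => sq_nonneg _
    · exact le_rfl
  have hcov : ∀ U h p, 0 ≤ cov U h p := fun U h p => by
    refine div_nonneg (Finset.sum_nonneg fun j _ => ?_) (by positivity)
    exact Finset.sum_nonneg fun a _ => Finset.sum_nonneg fun b _ => by positivity
  have hD : 0 ≤ Dmax :=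
    Real.iSup_nonneg fun p => integral_nonneg fun U => Real.iSup_nonneg fun h => hcov U h.1 p
  -- abbreviate the two functionals
  set cc := ∫ U, (f U - f ((fun t U e => U (e.1 + Pi.single 0 ((t : ℕ) : ZMod (2 * S + 1)), e.2) :
      ℕ → GaugeConfig 4 (2 * S + 1) G → GaugeConfig 4 (2 * S + 1) G) 1 U)) ^ 2 ∂μ with hcc
  set bb := ∑ t ∈ Finset.range (2 * S + 1), ∫ U, (f U - ∫ V, f V ∂μ) *
      (f ((fun t U e => U (e.1 + Pi.single 0 ((t : ℕ) : ZMod (2 * S + 1)), e.2) :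
        ℕ → GaugeConfig 4 (2 * S + 1) G → GaugeConfig 4 (2 * S + 1) G) t U) - ∫ V, f V ∂μ) ∂μ
    with hbb
  have h1 : Real.sqrt (cc * bb) ≤ Real.sqrt C_P * (Dmax * dir f) := by
    have hA' : cc * bb ≤ C_P * Dmax ^ 2 * dir f ^ 2 := by
      calc cc * bb = (∫ U, (f U - f ((fun U e => if e.1 0 = 0 ∧ e.2 ≠ 0 then
              plaquetteHolonomy U e.1 0 e.2 * U e else U e :
                GaugeConfig 4 (2 * S + 1) G → GaugeConfig 4 (2 * S + 1) G) U)) ^ 2 ∂μ) * bb := by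
            rw [hct]
        _ ≤ C_P * Dmax ^ 2 * dir f ^ 2 := hA
    calc Real.sqrt (cc * bb) ≤ Real.sqrt (C_P * Dmax ^ 2 * dir f ^ 2) := Real.sqrt_le_sqrt hA'
      _ = Real.sqrt C_P * (Dmax * dir f) := by
        rw [show C_P * Dmax ^ 2 * dir f ^ 2 = C_P * (Dmax * dir f) ^ 2 by ring,
          Real.sqrt_mul hCP.le, Real.sqrt_sq (mul_nonneg hD hdir)]
  have h2 : bb / (2 * S + 1 : ℝ) ≤ C_B * Dmax * dir f := by
    rw [div_le_iff₀ hL]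
    calc bb ≤ C_B * (2 * S + 1 : ℝ) * Dmax * dir f := hB
      _ = C_B * Dmax * dir f * (2 * S + 1 : ℝ) := by ring
  calc ∫ U, (f U - ∫ V, f V ∂μ) ^ 2 ∂μ ≤ 3 * Real.sqrt (cc * bb) + 4 * bb / (2 * S + 1 : ℝ) := hT
    _ ≤ 3 * (Real.sqrt C_P * (Dmax * dir f)) + 4 * (C_B * Dmax * dir f) := by
        rw [mul_div_assoc]
        gcongr
    _ = (3 * Real.sqrt C_P + 4 * C_B) * Dmax * dir f := by ring

end Summit.QuantumFields.YangMills.Theorems.BrascampLiebVacuum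

end
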